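import Summits.QuantumFields.YangMills.Theorems.AtomicCalibrationRGevreyExpNegInvGlue

/-!
# AtomicCalibrationR (stmt-QuantumFields-28169), E2 `stub_offDiagonalWhitney` — roadmap v3 item G.1 (second half):
# an explicit GEVREY-2 bump, smooth step and ℤ-periodic partition of unity

With the Gevrey-2 bound for `expNegInvGlue` (`…GevreyExpNegInvGlue`), this file builds, with EXPLICIT all-order derivative bounds
of the shape `C₀ · C₁^j · (j!)^2` consumed by `GevreyGridBump` / `GevreyPairCutoff` / `GevreyBandBump` (and with the support /
partition / threshold properties consumed by `GridPartition` and `PairCutoff`):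

* `bump x = expNegInvGlue x · expNegInvGlue (1 − x)` — `‖bump^{(m)}‖ ≤ (m!)^2 18^m` (Leibniz, `norm_iteratedFDeriv_mul_le`);
* `S = (∫₀ˣ bump) / ∫₀¹ bump` — smooth monotone step, `0` on `(−∞,0]`, `1` on `[1,∞)`, `‖S^{(j)}‖ ≤ C₀ 18^j (j!)^2`, `C₀ = max 1 I⁻¹`;
* `profile t = S (t+1) − S t` — smooth, `0 ≤ profile ≤ 1`, `tsupport ⊆ [−1,1]`, `Σ_{c∈ℤ} profile (t − c) = 1`, `‖D^j‖ ≤ 2C₀ 18^j (j!)^2`;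
* `step x = S (x − 2)` — `0` on `(−∞,2]`, `1` on `[3,∞)`, monotone, `0 ≤ step ≤ 1`, `‖D^j‖ ≤ C₀ 18^j (j!)^2`;
* packaged: `exists_gevrey_periodic_partition`, `exists_gevrey_step`, `exists_gevrey_profile_and_step` (common constants).

Mathlib + `…AtomicCalibrationRGevreyExpNegInvGlue` only.  No stub/crux/rung/summit is closed; nothing here touches Yang–Mills;
the YM mass gap is NOT proved. [folklore]
-/

set_option autoImplicit false

noncomputable section

open scoped ContDiff Topology
open Set Metric Filter
open Summit.QuantumFields.YangMills.Cruxes.AtomicCalibrationR.GevreyExpNegInvGlue (norm_iteratedFDeriv_expNegInvGlue_le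
  norm_iteratedFDeriv_expNegInvGlue_one_sub_le)

namespace Summit.QuantumFields.YangMills.Cruxes.AtomicCalibrationR.GevreyMollifier

/-! ### (B) The Gevrey bump `b(x) = expNegInvGlue(x)·expNegInvGlue(1−x)` and its normalised primitive -/

/-- The bump `b x = expNegInvGlue x · expNegInvGlue (1 − x)`: smooth, `≥ 0`, `> 0` exactly on `(0,1)`. -/
def bump (x : ℝ) : ℝ := expNegInvGlue x * expNegInvGlue (1 - x)

/-- `bump` is smooth. -/
theorem bump_contDiff : ContDiff ℝ ∞ bump :=
  (expNegInvGlue.contDiff (n := ⊤)).mul ((expNegInvGlue.contDiff (n := ⊤)).comp (contDiff_const.sub contDiff_id))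

/-- `bump` is continuous. -/
theorem bump_continuous : Continuous bump := bump_contDiff.continuous

/-- `bump ≥ 0`. -/
theorem bump_nonneg (x : ℝ) : 0 ≤ bump x := mul_nonneg (expNegInvGlue.nonneg _) (expNegInvGlue.nonneg _)

/-- `bump = 0` on `(−∞, 0]`. -/
theorem bump_eq_zero_of_nonpos {x : ℝ} (hx : x ≤ 0) : bump x = 0 := by
  simp [bump, expNegInvGlue.zero_of_nonpos hx]

/-- `bump = 0` on `[1, ∞)`. -/
theorem bump_eq_zero_of_one_le {x : ℝ} (hx : 1 ≤ x) : bump x = 0 := by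
  simp [bump, expNegInvGlue.zero_of_nonpos (show 1 - x ≤ 0 by linarith)]

/-- `bump > 0` on `(0, 1)`. -/
theorem bump_pos {x : ℝ} (h0 : 0 < x) (h1 : x < 1) : 0 < bump x :=
  mul_pos (expNegInvGlue.pos_of_pos h0) (expNegInvGlue.pos_of_pos (by linarith))

/-- **Gevrey-2 bound for the bump**: `‖bump^{(m)}‖ ≤ (m!)^2 · 18^m` (Leibniz). -/
theorem norm_iteratedFDeriv_bump_le (m : ℕ) (x : ℝ) :
    ‖iteratedFDeriv ℝ m bump x‖ ≤ ((Nat.factorial m : ℕ) : ℝ) ^ 2 * 18 ^ m := by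
  have hg : ContDiff ℝ ∞ (fun y : ℝ => expNegInvGlue (1 - y)) :=
    (expNegInvGlue.contDiff (n := ⊤)).comp (contDiff_const.sub contDiff_id)
  have h1 := norm_iteratedFDeriv_mul_le (𝕜 := ℝ) (N := (⊤ : ℕ∞)) (expNegInvGlue.contDiff (n := ⊤)) hg x (n := m)
    (by exact_mod_cast le_top)
  have hfun : bump = fun y => expNegInvGlue y * expNegInvGlue (1 - y) := rfl
  rw [hfun]
  refine h1.trans ?_
  have h18 : (18 : ℝ) ^ m = ∑ i ∈ Finset.range (m + 1), (9 : ℝ) ^ i * 9 ^ (m - i) * (m.choose i : ℝ) := by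
    have : (18 : ℝ) = 9 + 9 := by norm_num
    rw [this, add_pow]
  rw [h18, Finset.mul_sum]
  refine Finset.sum_le_sum fun i hi => ?_
  have him : i ≤ m := Nat.lt_succ_iff.1 (Finset.mem_range.1 hi)
  have hfac : ((Nat.factorial i : ℕ) : ℝ) * ((Nat.factorial (m - i) : ℕ) : ℝ) ≤ ((Nat.factorial m : ℕ) : ℝ) := by
    have h := Nat.le_of_dvd (Nat.factorial_pos m) (Nat.factorial_mul_factorial_dvd_factorial him)
    exact_mod_cast h
  calc (m.choose i : ℝ) * ‖iteratedFDeriv ℝ i expNegInvGlue x‖ * ‖iteratedFDeriv ℝ (m - i) (fun y => expNegInvGlue (1 - y)) x‖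
      ≤ (m.choose i : ℝ) * (((Nat.factorial i : ℕ) : ℝ) ^ 2 * 9 ^ i) * (((Nat.factorial (m - i) : ℕ) : ℝ) ^ 2 * 9 ^ (m - i)) := by
        refine mul_le_mul (mul_le_mul_of_nonneg_left (norm_iteratedFDeriv_expNegInvGlue_le i x) (Nat.cast_nonneg _))
          (norm_iteratedFDeriv_expNegInvGlue_one_sub_le (m - i) x) (norm_nonneg _) (mul_nonneg (Nat.cast_nonneg _) (by positivity))
    _ = (((Nat.factorial i : ℕ) : ℝ) * ((Nat.factorial (m - i) : ℕ) : ℝ)) ^ 2 * ((9 : ℝ) ^ i * 9 ^ (m - i) * (m.choose i : ℝ)) := by ring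
    _ ≤ ((Nat.factorial m : ℕ) : ℝ) ^ 2 * ((9 : ℝ) ^ i * 9 ^ (m - i) * (m.choose i : ℝ)) := by
        refine mul_le_mul_of_nonneg_right (pow_le_pow_left₀ (by positivity) hfac 2) (by positivity)

/-- The mass `I = ∫₀¹ bump`. -/
def bumpMass : ℝ := ∫ t in (0 : ℝ)..1, bump t

/-- `I > 0`. -/
theorem bumpMass_pos : 0 < bumpMass :=
  intervalIntegral.intervalIntegral_pos_of_pos_on (bump_continuous.intervalIntegrable 0 1)
    (fun _ hx => bump_pos hx.1 hx.2) zero_lt_one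

/-- The primitive `prim x = ∫₀ˣ bump`. -/
def prim (x : ℝ) : ℝ := ∫ t in (0 : ℝ)..x, bump t

/-- FTC: `prim' = bump`. -/
theorem hasDerivAt_prim (x : ℝ) : HasDerivAt prim (bump x) x :=
  (bump_continuous.integral_hasStrictDerivAt 0 x).hasDerivAt

/-- `deriv prim = bump`. -/
theorem deriv_prim : deriv prim = bump := funext fun x => (hasDerivAt_prim x).deriv

/-- `prim` is differentiable. -/
theorem prim_differentiable : Differentiable ℝ prim := fun x => (hasDerivAt_prim x).differentiableAt

/-- `prim` is smooth. -/
theorem prim_contDiff : ContDiff ℝ ∞ prim :=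
  contDiff_infty_iff_deriv.mpr ⟨prim_differentiable, by rw [deriv_prim]; exact bump_contDiff⟩

/-- `prim = 0` on `(−∞, 0]`. -/
theorem prim_of_nonpos {x : ℝ} (hx : x ≤ 0) : prim x = 0 := by
  unfold prim
  rw [intervalIntegral.integral_congr (g := fun _ => (0 : ℝ)) ?_, intervalIntegral.integral_zero]
  intro t ht
  rw [Set.uIcc_of_ge hx] at ht
  exact bump_eq_zero_of_nonpos ht.2

/-- `prim = I` on `[1, ∞)`. -/
theorem prim_of_one_le {x : ℝ} (hx : 1 ≤ x) : prim x = bumpMass := by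
  unfold prim bumpMass
  rw [← intervalIntegral.integral_add_adjacent_intervals (b := 1) (bump_continuous.intervalIntegrable 0 1)
    (bump_continuous.intervalIntegrable 1 x)]
  have h0 : ∫ t in (1 : ℝ)..x, bump t = 0 := by
    rw [intervalIntegral.integral_congr (g := fun _ => (0 : ℝ)) ?_, intervalIntegral.integral_zero]
    intro t ht
    rw [Set.uIcc_of_le hx] at ht
    exact bump_eq_zero_of_one_le ht.1
  rw [h0, add_zero]

/-- `prim` is monotone. -/
theorem prim_monotone : Monotone prim :=
  monotone_of_deriv_nonneg prim_differentiable fun x => by rw [deriv_prim]; exact bump_nonneg x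

/-- `0 ≤ prim`. -/
theorem prim_nonneg (x : ℝ) : 0 ≤ prim x := by
  rcases le_total x 0 with hx | hx
  · exact (prim_of_nonpos hx).symm.le
  · simpa [prim_of_nonpos le_rfl] using prim_monotone hx

/-- `prim ≤ I`. -/
theorem prim_le_bumpMass (x : ℝ) : prim x ≤ bumpMass := by
  rcases le_total x 1 with hx | hx
  · simpa [prim_of_one_le le_rfl] using prim_monotone hx
  · exact (prim_of_one_le hx).le

/-- **The Gevrey smooth step** `S = prim / I`: `C^∞`, monotone, `= 0` on `(−∞,0]`, `= 1` on `[1,∞)`. -/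
def S (x : ℝ) : ℝ := prim x / bumpMass

/-- `S` is smooth. -/
theorem S_contDiff : ContDiff ℝ ∞ S := prim_contDiff.div_const _

/-- `S = 0` on `(−∞, 0]`. -/
theorem S_of_nonpos {x : ℝ} (hx : x ≤ 0) : S x = 0 := by simp [S, prim_of_nonpos hx]

/-- `S = 1` on `[1, ∞)`. -/
theorem S_of_one_le {x : ℝ} (hx : 1 ≤ x) : S x = 1 := by
  simp [S, prim_of_one_le hx, div_self bumpMass_pos.ne']

/-- `S` is monotone. -/
theorem S_monotone : Monotone S := fun _ _ hab => div_le_div_of_nonneg_right (prim_monotone hab) bumpMass_pos.le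

/-- `0 ≤ S`. -/
theorem S_nonneg (x : ℝ) : 0 ≤ S x := div_nonneg (prim_nonneg x) bumpMass_pos.le

/-- `S ≤ 1`. -/
theorem S_le_one (x : ℝ) : S x ≤ 1 := (div_le_one bumpMass_pos).mpr (prim_le_bumpMass x)

/-- The Gevrey constant `C₀ = max 1 I⁻¹`. -/
def C₀ : ℝ := max 1 bumpMass⁻¹

/-- `1 ≤ C₀`. -/
theorem one_le_C₀ : 1 ≤ C₀ := le_max_left _ _

/-- Higher derivatives of `S` are those of `bump`, divided by `I`. -/
theorem iteratedDeriv_S_succ (i : ℕ) (x : ℝ) : iteratedDeriv (i + 1) S x = iteratedDeriv i bump x / bumpMass := by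
  have hS : S = fun y => prim y / bumpMass := rfl
  rw [hS, iteratedDeriv_div_const, iteratedDeriv_succ', deriv_prim]

/-- **Gevrey-2 bound for the step `S`**: `‖S^{(j)}‖ ≤ C₀ · 18^j · (j!)^2` for every `j`. -/
theorem norm_iteratedFDeriv_S_le (j : ℕ) (x : ℝ) :
    ‖iteratedFDeriv ℝ j S x‖ ≤ C₀ * 18 ^ j * ((Nat.factorial j : ℕ) : ℝ) ^ 2 := by
  rw [norm_iteratedFDeriv_eq_norm_iteratedDeriv]
  rcases j with _ | i
  · simp only [iteratedDeriv_zero, pow_zero, Nat.factorial_zero, Nat.cast_one, one_pow, mul_one]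
    rw [Real.norm_eq_abs, abs_of_nonneg (S_nonneg x)]
    exact (S_le_one x).trans one_le_C₀
  · rw [iteratedDeriv_S_succ, norm_div, Real.norm_eq_abs (bumpMass), abs_of_pos bumpMass_pos,
      ← norm_iteratedFDeriv_eq_norm_iteratedDeriv]
    have hb := norm_iteratedFDeriv_bump_le i x
    have hI : bumpMass⁻¹ ≤ C₀ := le_max_right _ _
    have hfac : ((Nat.factorial i : ℕ) : ℝ) ≤ ((Nat.factorial (i + 1) : ℕ) : ℝ) := by
      exact_mod_cast Nat.factorial_le (Nat.le_succ i)
    have h18 : (18 : ℝ) ^ i ≤ 18 ^ (i + 1) := pow_le_pow_right₀ (by norm_num) (Nat.le_succ i)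
    rw [div_eq_mul_inv]
    calc ‖iteratedFDeriv ℝ i bump x‖ * bumpMass⁻¹ ≤ (((Nat.factorial i : ℕ) : ℝ) ^ 2 * 18 ^ i) * C₀ :=
          mul_le_mul hb hI (inv_nonneg.mpr bumpMass_pos.le) (by positivity)
      _ ≤ (((Nat.factorial (i + 1) : ℕ) : ℝ) ^ 2 * 18 ^ (i + 1)) * C₀ :=
          mul_le_mul_of_nonneg_right (mul_le_mul (pow_le_pow_left₀ (by positivity) hfac 2) h18 (by positivity)
            (by positivity)) (zero_le_one.trans one_le_C₀)
      _ = C₀ * 18 ^ (i + 1) * ((Nat.factorial (i + 1) : ℕ) : ℝ) ^ 2 := by ring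

/-- Translates of `S` obey the same Gevrey bound. -/
theorem norm_iteratedFDeriv_S_add_const_le (a : ℝ) (j : ℕ) (x : ℝ) :
    ‖iteratedFDeriv ℝ j (fun t : ℝ => S (t + a)) x‖ ≤ C₀ * 18 ^ j * ((Nat.factorial j : ℕ) : ℝ) ^ 2 := by
  rw [norm_iteratedFDeriv_eq_norm_iteratedDeriv, iteratedDeriv_comp_add_const j S a, ← norm_iteratedFDeriv_eq_norm_iteratedDeriv]
  exact norm_iteratedFDeriv_S_le j (x + a)

/-! ### (C) The Gevrey profile (ℤ-periodic partition of unity) and the Gevrey step -/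

/-- The profile `φ t = S (t + 1) − S t`. -/
def profile (t : ℝ) : ℝ := S (t + 1) - S t

/-- `profile` is smooth. -/
theorem profile_contDiff : ContDiff ℝ ∞ profile :=
  (S_contDiff.comp (contDiff_id.add contDiff_const)).sub S_contDiff

/-- `0 ≤ profile`. -/
theorem profile_nonneg (t : ℝ) : 0 ≤ profile t := sub_nonneg.mpr (S_monotone (by linarith))

/-- `profile ≤ 1`. -/
theorem profile_le_one (t : ℝ) : profile t ≤ 1 := by
  have h1 := S_le_one (t + 1)
  have h2 := S_nonneg t
  unfold profile; linarith

/-- `‖profile t‖ ≤ 1`. -/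
theorem norm_profile_le_one (t : ℝ) : ‖profile t‖ ≤ 1 := by
  rw [Real.norm_eq_abs, abs_of_nonneg (profile_nonneg t)]; exact profile_le_one t

/-- `profile` vanishes outside `(−1, 1)`. -/
theorem profile_eq_zero {t : ℝ} (ht : t ≤ -1 ∨ 1 ≤ t) : profile t = 0 := by
  rcases ht with ht | ht
  · rw [profile, S_of_nonpos (by linarith), S_of_nonpos (by linarith), sub_zero]
  · rw [profile, S_of_one_le (by linarith), S_of_one_le ht, sub_self]

/-- `tsupport profile ⊆ [−1, 1]`. -/
theorem tsupport_profile_subset : tsupport profile ⊆ Icc (-1 : ℝ) 1 := by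
  refine closure_minimal (fun t ht => ?_) isClosed_Icc
  rw [Function.mem_support] at ht
  rw [mem_Icc]
  by_contra hcon
  rw [not_and_or, not_le, not_le] at hcon
  rcases hcon with h | h
  · exact ht (profile_eq_zero (Or.inl h.le))
  · exact ht (profile_eq_zero (Or.inr h.le))

/-- **Partition of unity**: `Σ_{c ∈ ℤ} profile (t − c) = 1` for every real `t` (telescoping). -/
theorem tsum_profile_sub_int (t : ℝ) : ∑' c : ℤ, profile (t - c) = 1 := by
  set k : ℤ := ⌊t⌋ with hk
  have hk1 : (k : ℝ) ≤ t := Int.floor_le t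
  have hk2 : t < (k : ℝ) + 1 := Int.lt_floor_add_one t
  have hzero : ∀ c : ℤ, c ∉ ({k, k + 1} : Finset ℤ) → profile (t - c) = 0 := by
    intro c hc
    simp only [Finset.mem_insert, Finset.mem_singleton, not_or] at hc
    obtain ⟨hc1, hc2⟩ := hc
    rcases lt_or_gt_of_ne hc1 with hlt | hgt
    · have hc' : c ≤ k - 1 := by omega
      have : (c : ℝ) ≤ (k : ℝ) - 1 := by exact_mod_cast hc'
      exact profile_eq_zero (Or.inr (by linarith))
    · have hc' : k + 2 ≤ c := by omega
      have : (k : ℝ) + 2 ≤ (c : ℝ) := by exact_mod_cast hc'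
      exact profile_eq_zero (Or.inl (by linarith))
  rw [tsum_eq_sum (s := ({k, k + 1} : Finset ℤ)) (fun c hc => hzero c hc)]
  have hne : k ≠ k + 1 := by omega
  rw [Finset.sum_pair hne]
  simp only [profile]
  push_cast
  have e1 : S (t - k + 1) = 1 := S_of_one_le (by linarith)
  have e2 : S (t - (k + 1)) = 0 := S_of_nonpos (by linarith)
  have e3 : t - ((k : ℝ) + 1) + 1 = t - k := by ring
  rw [e1, e2, e3]
  ring

/-- **Gevrey-2 bound for the profile**: `‖profile^{(j)}‖ ≤ (2C₀) · 18^j · (j!)^2`. -/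
theorem norm_iteratedFDeriv_profile_le (j : ℕ) (t : ℝ) :
    ‖iteratedFDeriv ℝ j profile t‖ ≤ (2 * C₀) * 18 ^ j * ((Nat.factorial j : ℕ) : ℝ) ^ 2 := by
  have hfun : profile = fun x => S (x + 1) - S x := rfl
  have h1 : ContDiff ℝ ∞ (fun x : ℝ => S (x + 1)) := S_contDiff.comp (contDiff_id.add contDiff_const)
  have h1j : ContDiff ℝ j (fun x : ℝ => S (x + 1)) := h1.of_le (by exact_mod_cast le_top)
  have h2j : ContDiff ℝ j S := S_contDiff.of_le (by exact_mod_cast le_top)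
  have hsub : iteratedFDeriv ℝ j (fun x : ℝ => S (x + 1) - S x) t =
      iteratedFDeriv ℝ j (fun x : ℝ => S (x + 1)) t - iteratedFDeriv ℝ j S t :=
    iteratedFDeriv_sub_apply (𝕜 := ℝ) (f := fun x : ℝ => S (x + 1)) (g := S) (i := j) (x := t) h1j.contDiffAt h2j.contDiffAt
  rw [hfun, hsub]
  calc ‖iteratedFDeriv ℝ j (fun x : ℝ => S (x + 1)) t - iteratedFDeriv ℝ j S t‖
      ≤ ‖iteratedFDeriv ℝ j (fun x : ℝ => S (x + 1)) t‖ + ‖iteratedFDeriv ℝ j S t‖ := norm_sub_le _ _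
    _ ≤ C₀ * 18 ^ j * ((Nat.factorial j : ℕ) : ℝ) ^ 2 + C₀ * 18 ^ j * ((Nat.factorial j : ℕ) : ℝ) ^ 2 :=
        add_le_add (norm_iteratedFDeriv_S_add_const_le 1 j t) (norm_iteratedFDeriv_S_le j t)
    _ = (2 * C₀) * 18 ^ j * ((Nat.factorial j : ℕ) : ℝ) ^ 2 := by ring

/-- The step `ψ x = S (x − 2)`: `= 0` on `(−∞, 2]`, `= 1` on `[3, ∞)`. -/
def step (x : ℝ) : ℝ := S (x - 2)

/-- `step` is smooth. -/
theorem step_contDiff : ContDiff ℝ ∞ step := S_contDiff.comp (contDiff_id.sub contDiff_const)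

/-- `step = 0` on `(−∞, 2]` (in particular on `(−∞, 1]`). -/
theorem step_eq_zero {x : ℝ} (hx : x ≤ 2) : step x = 0 := S_of_nonpos (by linarith)

/-- `step = 1` on `[3, ∞)` (in particular on `[4, ∞)`). -/
theorem step_eq_one {x : ℝ} (hx : 3 ≤ x) : step x = 1 := S_of_one_le (by linarith)

/-- `step` is monotone. -/
theorem step_monotone : Monotone step := fun _ _ hab => S_monotone (by linarith)

/-- `0 ≤ step`. -/
theorem step_nonneg (x : ℝ) : 0 ≤ step x := S_nonneg _

/-- `step ≤ 1`. -/
theorem step_le_one (x : ℝ) : step x ≤ 1 := S_le_one _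

/-- `‖step x‖ ≤ 1`. -/
theorem norm_step_le_one (x : ℝ) : ‖step x‖ ≤ 1 := by
  rw [Real.norm_eq_abs, abs_of_nonneg (step_nonneg x)]; exact step_le_one x

/-- **Gevrey-2 bound for the step**: `‖step^{(j)}‖ ≤ C₀ · 18^j · (j!)^2`. -/
theorem norm_iteratedFDeriv_step_le (j : ℕ) (x : ℝ) :
    ‖iteratedFDeriv ℝ j step x‖ ≤ C₀ * 18 ^ j * ((Nat.factorial j : ℕ) : ℝ) ^ 2 := by
  have hfun : step = fun t => S (t + (-2)) := by funext t; simp [step, sub_eq_add_neg]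
  rw [hfun]
  exact norm_iteratedFDeriv_S_add_const_le (-2) j x

/-! ### Packaged existence statements (the shapes consumed by `GevreyGridBump` / `GevreyBandBump` / `GevreyPairCutoff` and by
`GridPartition` in place of `PeriodicPartition.exists_smooth_periodic_partition` / `PairCutoff.stepψ`) -/

/-- **G.1 (profile).** A smooth `ℤ`-periodic partition of unity on `ℝ` with `tsupport ⊆ [−1, 1]`, `0 ≤ φ ≤ 1`, and EXPLICIT
Gevrey-2 derivative bounds `‖φ^{(j)}‖ ≤ C₀ C₁^j (j!)^2` for ALL orders `j` (`C₀, C₁ ≥ 1` independent of `j`). [folklore] -/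
theorem exists_gevrey_periodic_partition :
    ∃ φ : ℝ → ℝ, ContDiff ℝ ∞ φ ∧ tsupport φ ⊆ Icc (-1 : ℝ) 1 ∧ (∀ t, 0 ≤ φ t) ∧ (∀ t, φ t ≤ 1) ∧
      (∀ t, ∑' c : ℤ, φ (t - c) = 1) ∧
      ∃ C₀ C₁ : ℝ, 1 ≤ C₀ ∧ 1 ≤ C₁ ∧
        ∀ (j : ℕ) (t : ℝ), ‖iteratedFDeriv ℝ j φ t‖ ≤ C₀ * C₁ ^ j * ((Nat.factorial j : ℕ) : ℝ) ^ 2 :=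
  ⟨profile, profile_contDiff, tsupport_profile_subset, profile_nonneg, profile_le_one, tsum_profile_sub_int,
    2 * C₀, 18, by linarith [one_le_C₀], by norm_num, norm_iteratedFDeriv_profile_le⟩

/-- **G.1 (step).** A smooth monotone step, `= 0` on `(−∞, 1]`, `= 1` on `[4, ∞)` (indeed `0` on `(−∞,2]`, `1` on `[3,∞)`),
`0 ≤ ψ ≤ 1`, with EXPLICIT Gevrey-2 derivative bounds `‖ψ^{(j)}‖ ≤ C₀ C₁^j (j!)^2` for ALL orders `j`. [folklore] -/
theorem exists_gevrey_step :
    ∃ ψ : ℝ → ℝ, ContDiff ℝ ∞ ψ ∧ (∀ x, x ≤ 1 → ψ x = 0) ∧ (∀ x, 4 ≤ x → ψ x = 1) ∧ Monotone ψ ∧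
      (∀ x, 0 ≤ ψ x) ∧ (∀ x, ψ x ≤ 1) ∧
      ∃ C₀ C₁ : ℝ, 1 ≤ C₀ ∧ 1 ≤ C₁ ∧
        ∀ (j : ℕ) (x : ℝ), ‖iteratedFDeriv ℝ j ψ x‖ ≤ C₀ * C₁ ^ j * ((Nat.factorial j : ℕ) : ℝ) ^ 2 :=
  ⟨step, step_contDiff, fun _ hx => step_eq_zero (by linarith), fun _ hx => step_eq_one (by linarith), step_monotone,
    step_nonneg, step_le_one, C₀, 18, one_le_C₀, by norm_num, norm_iteratedFDeriv_step_le⟩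

/-- **G.1 (both, with COMMON constants)**, convenient for `GevreyBandBump.norm_iteratedFDeriv_bandBump_le_gevrey`. [folklore] -/
theorem exists_gevrey_profile_and_step :
    ∃ (φ ψ : ℝ → ℝ) (C₀ C₁ : ℝ), 1 ≤ C₀ ∧ 1 ≤ C₁ ∧
      ContDiff ℝ ∞ φ ∧ tsupport φ ⊆ Icc (-1 : ℝ) 1 ∧ (∀ t, 0 ≤ φ t) ∧ (∀ t, ‖φ t‖ ≤ 1) ∧ (∀ t, ∑' c : ℤ, φ (t - c) = 1) ∧
      (∀ (j : ℕ) (t : ℝ), ‖iteratedFDeriv ℝ j φ t‖ ≤ C₀ * C₁ ^ j * ((Nat.factorial j : ℕ) : ℝ) ^ 2) ∧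
      ContDiff ℝ ∞ ψ ∧ (∀ x, x ≤ 1 → ψ x = 0) ∧ (∀ x, 4 ≤ x → ψ x = 1) ∧ (∀ x, 0 ≤ ψ x) ∧ (∀ x, ‖ψ x‖ ≤ 1) ∧
      (∀ (j : ℕ) (x : ℝ), ‖iteratedFDeriv ℝ j ψ x‖ ≤ C₀ * C₁ ^ j * ((Nat.factorial j : ℕ) : ℝ) ^ 2) := by
  refine ⟨profile, step, 2 * C₀, 18, by linarith [one_le_C₀], by norm_num, profile_contDiff, tsupport_profile_subset,
    profile_nonneg, norm_profile_le_one, tsum_profile_sub_int, norm_iteratedFDeriv_profile_le, step_contDiff,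
    fun _ hx => step_eq_zero (by linarith), fun _ hx => step_eq_one (by linarith), step_nonneg, norm_step_le_one,
    fun j x => (norm_iteratedFDeriv_step_le j x).trans ?_⟩
  have h0 : 0 ≤ (18 : ℝ) ^ j * ((Nat.factorial j : ℕ) : ℝ) ^ 2 := by positivity
  nlinarith [one_le_C₀]

end Summit.QuantumFields.YangMills.Cruxes.AtomicCalibrationR.GevreyMollifier

end
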